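import Summits.AtomisticToContinuum.FouriersLaw.Theses.MatthiessenLadder
import Literature.MathematicalPhysics.KineticTheory.SiteChainFokkerPlanckInvariance
import Literature.MathematicalPhysics.KineticTheory.CellChainLangevin
import HarnessLib

/-!
# Weak steady states of a cell chain with a smooth density are invariant for its Langevin kernels

Helper for crux `PrefixSteadyStates` (route `MatthiessenLadder`, item stmt-AtomisticToContinuum-12778,
registered stub `stub_cellChainInvariantOfSteadyState`): the **Fokker–Planck identification** for the
CELL CHAINS `cellChain ω₂ lam β γ c` (`ω₂ > 0`, `lam, β ≥ 0`, `γ > 0`, any cell indicator `c`,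
`N ≥ 1`, `T_L, T_R > 0`). A weak steady state `μ` (`∫ L f dμ = 0` on `C_c^∞`) which HAS a smooth
density `ρ` (hypothesis `HasSmoothDensity μ`; supplied by the Hörmander stub of the skeleton) is an
invariant measure of the Langevin transition kernels
`(cellChain ω₂ lam β γ c).langevinKernel N T_L T_R t` (`SiteChainLangevinKernel.lean`):

* integration by parts makes `ρ` a pointwise solution of `L̂ρ + 2γρ = 0`
  (`SiteChain.revGenerator_add_eq_zero_of_weak`, `SiteChainFokkerPlanckIBP.lean`);
* the energy sublevel sets of a cell chain lie in balls of radius `O(√E)`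
  (`cellChain_setOf_hamiltonian_le_subset_closedBall`), hence have polynomially bounded volume
  (`cellChain_volume_sublevel_le`);
* the generic identification `SiteChain.UniformlyConfining.withDensity_bind_langevinKernel_of_revGenerator`
  (`SiteChainFokkerPlanckInvariance.lean`: duality, truncation, Duhamel, Fatou) gives
  `(ρ dx).bind P_t = ρ dx`, i.e. `Kernel.Invariant (P_t) μ`.

All ingredients are in-tree theorems over a general `SiteChain` with `UniformlyConfining` potentials
(`cellChain_uniformlyConfining`); nothing is assumed.
-/

noncomputable section

open MeasureTheory ProbabilityTheory Filter Topology Set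
open scoped NNReal ENNReal ContDiff

namespace Summit.AtomisticToContinuum.FouriersLaw.Theorems.PrefixSteadyStates.LineRegistered

open Literature.MathematicalPhysics.KineticTheory.HeatConduction
open Literature.MathematicalPhysics.KineticTheory Literature.Probability.Process

variable {N : ℕ}

/-! ### Polynomial volume growth of the energy sublevel sets of a cell chain -/

/-- A sublevel set `{H ≤ E}` of a cell chain (`ω₂ > 0`, `lam, β ≥ 0`) lies in the closed ball of
radius `max(√(2E/ω₂), √(2E))` of phase space (sup norm): `ω₂ q_i²/2 ≤ U_i(q_i) ≤ H` and
`p_i²/2 ≤ H`. [folklore] -/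
theorem cellChain_setOf_hamiltonian_le_subset_closedBall {ω₂ lam β : ℝ} (hω : 0 < ω₂) (hl : 0 ≤ lam)
    (hβ : 0 ≤ β) (γ : ℝ) (c : ℕ → Bool) (N : ℕ) (E : ℝ) :
    {x : PhaseSpace N | (cellChain ω₂ lam β γ c).hamiltonian N x ≤ E} ⊆
      Metric.closedBall 0 (max (Real.sqrt (2 * E / ω₂)) (Real.sqrt (2 * E))) := by
  intro x hx
  rw [mem_setOf_eq] at hx
  set P := cellChain ω₂ lam β γ c with hPdef
  have hU0 : ∀ i q, 0 ≤ P.U i q := fun i q => by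
    obtain ⟨hl0, -⟩ := ite_amplitude_mem_Icc hl (c i)
    show 0 ≤ ω₂ * q ^ 2 / 2 + (if c i then lam else 0) * q ^ 4 / 4
    positivity
  have hV0 : ∀ i r, 0 ≤ P.V i r := fun i r => by
    obtain ⟨hb0, -⟩ := ite_amplitude_mem_Icc hβ (c i)
    show 0 ≤ r ^ 2 / 2 + (if c i then β else 0) * r ^ 4 / 4
    positivity
  have hsite := fun i => (P.site_le_hamiltonian hU0 hV0 N x i).trans hx
  have hUq : ∀ i : Fin N, ω₂ * x.1 i ^ 2 / 2 ≤ P.U i.val (x.1 i) := fun i => by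
    obtain ⟨hl0, -⟩ := ite_amplitude_mem_Icc hl (c i.val)
    show ω₂ * x.1 i ^ 2 / 2 ≤ ω₂ * x.1 i ^ 2 / 2 + (if c i.val then lam else 0) * x.1 i ^ 4 / 4
    have : 0 ≤ (if c i.val then lam else 0) * x.1 i ^ 4 / 4 := by positivity
    linarith
  have hq : ∀ i, ω₂ * x.1 i ^ 2 / 2 ≤ E := fun i => by
    have h1 := hsite i
    have h2 := hUq i
    nlinarith [sq_nonneg (x.2 i)]
  have hp : ∀ i, x.2 i ^ 2 / 2 ≤ E := fun i => by
    have h1 := hsite i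
    linarith [hU0 i.val (x.1 i)]
  rw [Metric.mem_closedBall, dist_zero_right, Prod.norm_def, max_le_iff]
  constructor
  · refine (pi_norm_le_iff_of_nonneg (by positivity)).2 fun i => ?_
    rw [Real.norm_eq_abs]
    refine (le_max_left _ _).trans' ?_
    rw [← Real.sqrt_sq_eq_abs]
    exact Real.sqrt_le_sqrt (by rw [le_div_iff₀ hω]; nlinarith [hq i])
  · refine (pi_norm_le_iff_of_nonneg (by positivity)).2 fun i => ?_
    rw [Real.norm_eq_abs]
    refine (le_max_right _ _).trans' ?_
    rw [← Real.sqrt_sq_eq_abs]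
    exact Real.sqrt_le_sqrt (by nlinarith [hp i])

/-- **The energy sublevel sets of a cell chain have polynomially bounded volume**: for `ω₂ > 0`,
`lam, β ≥ 0` there are `C ≥ 0`, `d : ℕ` with `|{H ≤ E}| ≤ C E^d` for all `E ≥ 1` (`{H ≤ E}` lies in
the ball of radius `max(√(2E/ω₂), √(2E)) ≤ κ E`, and Lebesgue measure scales like `r^{dim}`).
[folklore] -/
theorem cellChain_volume_sublevel_le {ω₂ lam β : ℝ} (hω : 0 < ω₂) (hl : 0 ≤ lam) (hβ : 0 ≤ β) (γ : ℝ)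
    (c : ℕ → Bool) (N : ℕ) : ∃ (C : ℝ) (d : ℕ), 0 ≤ C ∧ ∀ E : ℝ, 1 ≤ E →
      (volume {x : PhaseSpace N | (cellChain ω₂ lam β γ c).hamiltonian N x ≤ E}).toReal ≤ C * E ^ d := by
  haveI : (volume : Measure (PhaseSpace N)).IsAddHaarMeasure := Measure.prod.instIsAddHaarMeasure _ _
  set d := Module.finrank ℝ (PhaseSpace N)
  set κ := max (Real.sqrt (2 / ω₂)) (Real.sqrt 2) with hκ
  set v₁ := (volume (Metric.ball (0 : PhaseSpace N) 1)).toReal with hv₁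
  have hκ0 : 0 ≤ κ := le_max_of_le_right (Real.sqrt_nonneg _)
  have hv₁0 : 0 ≤ v₁ := ENNReal.toReal_nonneg
  refine ⟨κ ^ d * v₁, d, by positivity, fun E hE => ?_⟩
  have hE0 : 0 ≤ E := by linarith
  set r := max (Real.sqrt (2 * E / ω₂)) (Real.sqrt (2 * E)) with hr
  have hr0 : 0 ≤ r := le_max_of_le_right (Real.sqrt_nonneg _)
  have hsub := cellChain_setOf_hamiltonian_le_subset_closedBall hω hl hβ γ c N E
  have hrκ : r ≤ κ * E := by
    have hsqE : Real.sqrt E ≤ E := by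
      rw [Real.sqrt_le_left hE0]
      nlinarith
    refine max_le ?_ ?_
    · calc Real.sqrt (2 * E / ω₂) = Real.sqrt (2 / ω₂) * Real.sqrt E := by
            rw [← Real.sqrt_mul (by positivity)]; ring_nf
        _ ≤ κ * E := mul_le_mul (le_max_left _ _) hsqE (Real.sqrt_nonneg _) hκ0
    · calc Real.sqrt (2 * E) = Real.sqrt 2 * Real.sqrt E := Real.sqrt_mul (by norm_num) E
        _ ≤ κ * E := mul_le_mul (le_max_right _ _) hsqE (Real.sqrt_nonneg _) hκ0
  calc (volume {x : PhaseSpace N | (cellChain ω₂ lam β γ c).hamiltonian N x ≤ E}).toReal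
      ≤ (volume (Metric.closedBall (0 : PhaseSpace N) r)).toReal :=
        ENNReal.toReal_mono (measure_closedBall_lt_top).ne (measure_mono hsub)
    _ = r ^ d * v₁ := by
        rw [Measure.addHaar_closedBall volume (0 : PhaseSpace N) hr0, ENNReal.toReal_mul,
          ENNReal.toReal_ofReal (by positivity)]
    _ ≤ (κ * E) ^ d * v₁ := mul_le_mul_of_nonneg_right (pow_le_pow_left₀ hr0 hrκ d) hv₁0
    _ = κ ^ d * v₁ * E ^ d := by ring

/-! ### The stub: weak steady states with a smooth density are invariant -/

/-- **Weak steady states of a cell chain with a smooth density are invariant for its Langevin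
kernels** (the Fokker–Planck identification). For `ω₂ > 0`, `lam, β ≥ 0`, `γ > 0`, every cell
indicator `c`, `N ≥ 1`, `T_L, T_R > 0`: if `μ` is a weak steady state of `cellChain ω₂ lam β γ c`
(`SiteChain.IsSteadyState`: probability, `∫ L f dμ = 0` on `C_c^∞`) and has a smooth density
`ρ` (`HasSmoothDensity μ`), then integration by parts gives `L̂ρ + 2γρ = 0` pointwise
(`SiteChain.revGenerator_add_eq_zero_of_weak`), the sublevel sets of `H` have polynomial volume
growth (`cellChain_volume_sublevel_le`), and the generic identification
`SiteChain.UniformlyConfining.withDensity_bind_langevinKernel_of_revGenerator` (Lebesgue duality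
`dx P_t(x,dy) = e^{2γt} dy P̂_t(y,dx)`, truncations with small `L¹` defect, Duhamel, Fatou) yields
`μ.bind P_t = μ` for every `t ≥ 0`. [cite: CuneoEckmannHairerReyBellet2018, Thm 2.13 and §3.1] -/
theorem stub_cellChainInvariantOfSteadyState :
    ∀ ω₂ lam β γ : ℝ, 0 < ω₂ → 0 ≤ lam → 0 ≤ β → 0 < γ → ∀ (c : ℕ → Bool) (N : ℕ), 0 < N →
      ∀ T_L T_R : ℝ, 0 < T_L → 0 < T_R →
        ∀ μ : Measure (PhaseSpace N),
          (cellChain ω₂ lam β γ c).IsSteadyState N T_L T_R μ → HasSmoothDensity μ →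
            ∀ t : ℝ≥0, ProbabilityTheory.Kernel.Invariant
              ((cellChain ω₂ lam β γ c).langevinKernel N T_L T_R t) μ := by
  intro ω₂ lam β γ hω hl hβ hγ c N hN T_L T_R hL hR μ hμ hsm t
  set P := cellChain ω₂ lam β γ c with hPdef
  have hP : P.UniformlyConfining := cellChain_uniformlyConfining hω hl hβ hγ.le c
  have hPγ : P.γ = γ := rfl
  obtain ⟨hprob, hweak, -⟩ := hμ
  obtain ⟨ρ, hρs, hρ0, hμρ⟩ := hsm
  have hρ2 : ContDiff ℝ 2 ρ := hρs.of_le (by norm_cast)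
  have hρc : Continuous ρ := hρs.continuous
  -- the density is integrable (`μ` is a probability measure)
  have hlin : ∫⁻ x, ENNReal.ofReal (ρ x) = μ Set.univ := by
    rw [hμρ, withDensity_apply _ MeasurableSet.univ, Measure.restrict_univ]
  have hρi : Integrable ρ := by
    refine ⟨hρc.aestronglyMeasurable, ?_⟩
    rw [hasFiniteIntegral_iff_enorm]
    have e : ∀ x, ‖ρ x‖ₑ = ENNReal.ofReal (ρ x) := fun x => Real.enorm_eq_ofReal (hρ0 x)
    simp_rw [e, hlin]
    exact measure_lt_top μ _
  -- the weak equation against the density, and the pointwise Fokker–Planck equation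
  have hweak' : ∀ φ : PhaseSpace N → ℝ, ContDiff ℝ ∞ φ → HasCompactSupport φ →
      ∫ x, P.generator N T_L T_R φ x * ρ x = 0 := by
    intro φ hφ hφc
    have h := hweak φ hφ hφc
    have e : (fun x => ENNReal.ofReal (ρ x)) = fun x => ((ρ x).toNNReal : ℝ≥0∞) := rfl
    rw [hμρ, e, integral_withDensity_eq_integral_smul hρc.measurable.real_toNNReal] at h
    rw [← h]
    refine integral_congr_ae (Eventually.of_forall fun x => ?_)
    show P.generator N T_L T_R φ x * ρ x = (ρ x).toNNReal • P.generator N T_L T_R φ x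
    rw [NNReal.smul_def, smul_eq_mul, Real.coe_toNNReal _ (hρ0 x), mul_comm]
  have hγL : 0 ≤ P.γ * T_L := by rw [hPγ]; exact mul_nonneg hγ.le hL.le
  have hγR : 0 ≤ P.γ * T_R := by rw [hPγ]; exact mul_nonneg hγ.le hR.le
  have hpde := P.revGenerator_add_eq_zero_of_weak hP.contDiff_U hP.contDiff_V hN hγL hγR hρ2 hweak'
  -- polynomial volume growth of the sublevel sets
  have hvol : ∃ (C : ℝ) (d : ℕ), 0 ≤ C ∧ ∀ R : ℝ, 1 ≤ R →
      (volume {x : PhaseSpace N | P.hamiltonian N x ≤ 4 * R}).toReal ≤ C * R ^ d := by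
    obtain ⟨C, d, hC, hCE⟩ := cellChain_volume_sublevel_le hω hl hβ γ c N
    refine ⟨C * 4 ^ d, d, by positivity, fun R hR1 => ?_⟩
    have h := hCE (4 * R) (by linarith)
    calc (volume {x : PhaseSpace N | P.hamiltonian N x ≤ 4 * R}).toReal ≤ C * (4 * R) ^ d := h
      _ = C * 4 ^ d * R ^ d := by rw [mul_pow]; ring
  -- invariance of `ρ dx` for the Langevin kernels
  have hinv := hP.withDensity_bind_langevinKernel_of_revGenerator hN hL.le hR.le hρ2 hρ0 hρi hpde hvol t
  show μ.bind (P.langevinKernel N T_L T_R t) = μ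
  rw [hμρ]
  exact hinv

end Summit.AtomisticToContinuum.FouriersLaw.Theorems.PrefixSteadyStates.LineRegistered

end
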